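import Summits.Schanuel.Schanuel.Theorems.ZilberEacFibrationMM
import HarnessLib

/-!
# The density lift `W_e(S) = {(s, x, y) : s ∈ S, y = x · e(s)}`, I: algebra

Zilber's Exponential-Algebraic Closedness, case ladder (host summit Schanuel, cell `pub-schanuel`,
seat 2, gen 6).  This is the first file of the CONVERSE of the gen-5 bridge
`ecCellPeriodicStdFib_two_of_mmDensityFree` ("free Mantova–Masser density ⇒ the fibred periodic
piece `ECCellPeriodicStdFib 2` of `EC(3,2)`").  The converse rests on one construction: for
`S ⊆ ℂ^d × ℂ^d` and a polynomial `e`, the **density lift**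

  `W_e(S) = {w ∈ ℂ^{d+1} × ℂ^{d+1} : pr w ∈ S, y_last = x_last · e(pr w)}`

(`pr` forgets the last coordinate of each sort).  An exponential point of `W_e(S)` is an exponential
point `s` of `S` together with `x` solving `e^x = x · e(s)`; since `e^x ≠ 0` it has `e(s) ≠ 0`.
So if `W_e(S)` lies in a cell of `EC(d+1, d)` known (or assumed) to be solvable for every
`e ∉ I(S)`, the exponential points of `S` are Zariski dense.

This file: `W_e(S) ≅ S × 𝔸¹` algebraically — the substitution
`liftHom e : ℂ[x, x_last, y, y_last] → ℂ[x, y][T]`, `x_last ↦ T`, `y_last ↦ T · e`, has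
`I(W_e(S)) = liftHom⁻¹ (I(S)[T])` (`vanishingIdeal_liftVar`), whence `W_e(S)` is Zariski closed
(`isZariskiClosed_liftVar`), irreducible when `S` is (`isIrreducibleClosed_liftVar`), and
`dim W_e(S) = dim S + 1` (`zariskiDim_liftVar`).  Elementary commutative algebra throughout.

HONEST FRAMING: bookkeeping towards an equivalence between an OPEN piece of `EC(3,2)` and a question
OPEN in print; `EC(3,2)` OPEN; nothing here bears on Schanuel's conjecture (EAC ⇏ SC).
-/

noncomputable section

open MvPolynomial
open Literature.NumberTheory.Transcendental Literature.ModelTheory.Zilber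

set_option linter.dupNamespace false

namespace Summit.Schanuel.Schanuel.Theorems

variable {K : Type*} [Field K] {d : ℕ}

/-! ## The lift: points, set, substitution -/

/-- The point of `K^{d+1} × K^{d+1}` over `s ∈ K^d × K^d` with last additive coordinate `x` and last
multiplicative coordinate `x · e(s)`. [folklore] -/
def liftPt (e : MvPolynomial (Fin d ⊕ Fin d) K) (s : Fin d ⊕ Fin d → K) (x : K) :
    Fin (d + 1) ⊕ Fin (d + 1) → K :=
  Sum.elim (Fin.snoc (fun i => s (Sum.inl i)) x)
    (Fin.snoc (fun i => s (Sum.inr i)) (x * MvPolynomial.eval s e))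

/-- **The density lift** `W_e(S) = {w : pr w ∈ S, y_last = x_last · e(pr w)}`. [folklore] -/
def liftVar (e : MvPolynomial (Fin d ⊕ Fin d) K) (S : Set (Fin d ⊕ Fin d → K)) :
    Set (Fin (d + 1) ⊕ Fin (d + 1) → K) :=
  {w | (fun t : Fin d ⊕ Fin d => w (Sum.map Fin.castSucc Fin.castSucc t)) ∈ S ∧
    w (Sum.inr (Fin.last d)) = w (Sum.inl (Fin.last d)) *
      MvPolynomial.eval (fun t : Fin d ⊕ Fin d => w (Sum.map Fin.castSucc Fin.castSucc t)) e}

/-- The substitution `K[x, x_last, y, y_last] → K[x, y][T]`: `x_last ↦ T`, `y_last ↦ T · e`, the other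
variables to themselves (as constants). [folklore] -/
def liftHom (e : MvPolynomial (Fin d ⊕ Fin d) K) :
    MvPolynomial (Fin (d + 1) ⊕ Fin (d + 1)) K →ₐ[K] Polynomial (MvPolynomial (Fin d ⊕ Fin d) K) :=
  MvPolynomial.aeval
    (Sum.elim (Fin.snoc (fun i => Polynomial.C (X (Sum.inl i))) Polynomial.X)
      (Fin.snoc (fun i => Polynomial.C (X (Sum.inr i))) (Polynomial.X * Polynomial.C e)))

variable (e : MvPolynomial (Fin d ⊕ Fin d) K)

/-- Small additive coordinates of `liftPt`. [folklore] -/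
@[simp] theorem liftPt_inl_castSucc (s : Fin d ⊕ Fin d → K) (x : K) (i : Fin d) :
    liftPt e s x (Sum.inl (Fin.castSucc i)) = s (Sum.inl i) := by
  simp [liftPt]

/-- Small multiplicative coordinates of `liftPt`. [folklore] -/
@[simp] theorem liftPt_inr_castSucc (s : Fin d ⊕ Fin d → K) (x : K) (i : Fin d) :
    liftPt e s x (Sum.inr (Fin.castSucc i)) = s (Sum.inr i) := by
  simp [liftPt]

/-- Last additive coordinate of `liftPt`. [folklore] -/
@[simp] theorem liftPt_inl_last (s : Fin d ⊕ Fin d → K) (x : K) :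
    liftPt e s x (Sum.inl (Fin.last d)) = x := by
  simp [liftPt]

/-- Last multiplicative coordinate of `liftPt`. [folklore] -/
@[simp] theorem liftPt_inr_last (s : Fin d ⊕ Fin d → K) (x : K) :
    liftPt e s x (Sum.inr (Fin.last d)) = x * MvPolynomial.eval s e := by
  simp [liftPt]

/-- `pr (liftPt e s x) = s`. [folklore] -/
theorem pr_liftPt (s : Fin d ⊕ Fin d → K) (x : K) :
    (fun t : Fin d ⊕ Fin d => liftPt e s x (Sum.map Fin.castSucc Fin.castSucc t)) = s := by
  funext t
  rcases t with i | i
  · simp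
  · simp

/-- The additive projection of `liftPt e s x` is `(π s, x)`. [folklore] -/
theorem projAdd_liftPt (s : Fin d ⊕ Fin d → K) (x : K) :
    projAdd (liftPt e s x) = Fin.snoc (projAdd s) x := by
  funext j
  rcases Fin.eq_castSucc_or_eq_last j with ⟨i, rfl⟩ | rfl
  · rw [projAdd_apply, liftPt_inl_castSucc, Fin.snoc_castSucc, projAdd_apply]
  · rw [projAdd_apply, liftPt_inl_last, Fin.snoc_last]

/-- `liftPt e s x ∈ W_e(S) ↔ s ∈ S`. [folklore] -/
theorem liftPt_mem_liftVar_iff {S : Set (Fin d ⊕ Fin d → K)} (s : Fin d ⊕ Fin d → K) (x : K) :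
    liftPt e s x ∈ liftVar e S ↔ s ∈ S := by
  simp only [liftVar, Set.mem_setOf_eq, liftPt_inr_last, liftPt_inl_last]
  rw [pr_liftPt]
  simp

/-- A point agreeing with `liftPt e (pr w) (x_last w)` away from `y_last` is that point iff its
`y_last` is `x_last · e(pr w)`; in particular every point of `W_e(S)` is a `liftPt`. [folklore] -/
theorem eq_liftPt_of_mem {S : Set (Fin d ⊕ Fin d → K)} {w : Fin (d + 1) ⊕ Fin (d + 1) → K}
    (hw : w ∈ liftVar e S) :
    w = liftPt e (fun t : Fin d ⊕ Fin d => w (Sum.map Fin.castSucc Fin.castSucc t))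
      (w (Sum.inl (Fin.last d))) := by
  funext j
  rcases j with j | j
  · rcases Fin.eq_castSucc_or_eq_last j with ⟨i, rfl⟩ | rfl
    · rw [liftPt_inl_castSucc, Sum.map_inl]
    · rw [liftPt_inl_last]
  · rcases Fin.eq_castSucc_or_eq_last j with ⟨i, rfl⟩ | rfl
    · rw [liftPt_inr_castSucc, Sum.map_inr]
    · rw [liftPt_inr_last]
      exact hw.2

/-- Membership in `W_e(S)`: the points are exactly the `liftPt e s x`, `s ∈ S`. [folklore] -/
theorem mem_liftVar_iff {S : Set (Fin d ⊕ Fin d → K)} {w : Fin (d + 1) ⊕ Fin (d + 1) → K} :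
    w ∈ liftVar e S ↔ ∃ s ∈ S, ∃ x : K, w = liftPt e s x := by
  constructor
  · intro hw
    exact ⟨_, hw.1, _, eq_liftPt_of_mem e hw⟩
  · rintro ⟨s, hs, x, rfl⟩
    exact (liftPt_mem_liftVar_iff e s x).2 hs

/-! ## The substitution on variables -/

/-- `liftHom` on a small additive variable. [folklore] -/
@[simp] theorem liftHom_X_inl_castSucc (i : Fin d) :
    liftHom e (X (Sum.inl (Fin.castSucc i))) = Polynomial.C (X (Sum.inl i)) := by
  simp [liftHom]

/-- `liftHom` on a small multiplicative variable. [folklore] -/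
@[simp] theorem liftHom_X_inr_castSucc (i : Fin d) :
    liftHom e (X (Sum.inr (Fin.castSucc i))) = Polynomial.C (X (Sum.inr i)) := by
  simp [liftHom]

/-- `liftHom` on `x_last`. [folklore] -/
@[simp] theorem liftHom_X_inl_last :
    liftHom e (X (Sum.inl (Fin.last d))) = Polynomial.X := by
  simp [liftHom]

/-- `liftHom` on `y_last`. [folklore] -/
@[simp] theorem liftHom_X_inr_last :
    liftHom e (X (Sum.inr (Fin.last d))) = Polynomial.X * Polynomial.C e := by
  simp [liftHom]

/-- On polynomials in the small variables the substitution is the inclusion of constants: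
`liftHom e (f(x, y)) = C f`. [folklore] -/
theorem liftHom_rename (f : MvPolynomial (Fin d ⊕ Fin d) K) :
    liftHom e (rename (Sum.map (Fin.castSucc (n := d)) (Fin.castSucc (n := d))) f) =
      Polynomial.C f := by
  induction f using MvPolynomial.induction_on with
  | C a =>
    rw [rename_C]
    change liftHom e (algebraMap K _ a) = _
    rw [AlgHom.commutes, Polynomial.algebraMap_apply, MvPolynomial.algebraMap_eq]
  | add p q hp hq => rw [map_add, map_add, hp, hq, Polynomial.C_add]
  | mul_X p t hp =>
    rw [map_mul, map_mul, hp, rename_X, Polynomial.C_mul]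
    rcases t with i | i
    · rw [Sum.map_inl, liftHom_X_inl_castSucc]
    · rw [Sum.map_inr, liftHom_X_inr_castSucc]

/-- **Evaluation through the substitution**: `p(liftPt e s x) = (liftHom e p)^{s}(x)`, where
`q^{s}` maps the coefficients of `q ∈ K[x,y][T]` by evaluation at `s`. [folklore] -/
theorem eval_liftPt (s : Fin d ⊕ Fin d → K) (x : K)
    (p : MvPolynomial (Fin (d + 1) ⊕ Fin (d + 1)) K) :
    MvPolynomial.eval (liftPt e s x) p = ((liftHom e p).map (MvPolynomial.eval s)).eval x := by
  induction p using MvPolynomial.induction_on with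
  | C a =>
    rw [eval_C]
    change a = ((liftHom e (algebraMap K _ a)).map _).eval x
    rw [AlgHom.commutes, Polynomial.algebraMap_apply, MvPolynomial.algebraMap_eq, Polynomial.map_C,
      eval_C, Polynomial.eval_C]
  | add p q hp hq => rw [map_add, map_add, Polynomial.map_add, Polynomial.eval_add, hp, hq]
  | mul_X p j hp =>
    rw [map_mul, eval_X, map_mul, Polynomial.map_mul, Polynomial.eval_mul, hp]
    congr 1
    rcases j with j | j
    · rcases Fin.eq_castSucc_or_eq_last j with ⟨i, rfl⟩ | rfl
      · rw [liftPt_inl_castSucc, liftHom_X_inl_castSucc, Polynomial.map_C, Polynomial.eval_C, eval_X]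
      · rw [liftPt_inl_last, liftHom_X_inl_last, Polynomial.map_X, Polynomial.eval_X]
    · rcases Fin.eq_castSucc_or_eq_last j with ⟨i, rfl⟩ | rfl
      · rw [liftPt_inr_castSucc, liftHom_X_inr_castSucc, Polynomial.map_C, Polynomial.eval_C, eval_X]
      · rw [liftPt_inr_last, liftHom_X_inr_last, Polynomial.map_mul, Polynomial.map_X,
          Polynomial.map_C, Polynomial.eval_mul, Polynomial.eval_X, Polynomial.eval_C]

/-! ## The vanishing ideal of the lift -/

variable [Infinite K]

/-- **`I(W_e(S))` coefficientwise**: `p` vanishes on `W_e(S)` iff every `T`-coefficient of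
`liftHom e p ∈ K[x,y][T]` vanishes on `S` (for fixed `s ∈ S` the one-variable polynomial
`(liftHom e p)^{s}` vanishes at every `x ∈ K`, an infinite field). [folklore] -/
theorem mem_vanishingIdeal_liftVar_iff (S : Set (Fin d ⊕ Fin d → K))
    (p : MvPolynomial (Fin (d + 1) ⊕ Fin (d + 1)) K) :
    p ∈ vanishingIdeal K (liftVar e S) ↔ ∀ k, (liftHom e p).coeff k ∈ vanishingIdeal K S := by
  constructor
  · intro hp k
    rw [mem_vanishingIdeal_iff]
    intro s hs
    have hq : (liftHom e p).map (MvPolynomial.eval s) = 0 := by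
      refine Polynomial.funext fun x => ?_
      rw [Polynomial.eval_zero, ← eval_liftPt]
      exact (mem_vanishingIdeal_iff.1 hp) _ ((liftPt_mem_liftVar_iff e s x).2 hs)
    have := congrArg (fun q => q.coeff k) hq
    simp only [Polynomial.coeff_map, Polynomial.coeff_zero] at this
    exact this
  · intro h
    rw [mem_vanishingIdeal_iff]
    intro w hw
    obtain ⟨s, hs, x, rfl⟩ := (mem_liftVar_iff e).1 hw
    change MvPolynomial.eval (liftPt e s x) p = 0
    rw [eval_liftPt]
    have hq : (liftHom e p).map (MvPolynomial.eval s) = 0 := by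
      ext k
      rw [Polynomial.coeff_map, Polynomial.coeff_zero]
      exact (mem_vanishingIdeal_iff.1 (h k)) s hs
    rw [hq, Polynomial.eval_zero]

/-- **`I(W_e(S)) = liftHom⁻¹ (I(S) · K[x,y][T])`.** [folklore] -/
theorem vanishingIdeal_liftVar (S : Set (Fin d ⊕ Fin d → K)) :
    vanishingIdeal K (liftVar e S) =
      (Ideal.map (Polynomial.C : MvPolynomial (Fin d ⊕ Fin d) K →+* _) (vanishingIdeal K S)).comap
        (liftHom e) := by
  ext p
  rw [mem_vanishingIdeal_liftVar_iff, Ideal.mem_comap, Ideal.mem_map_C_iff]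

/-- Polynomials in the small variables vanishing on `S` vanish on the lift. [folklore] -/
theorem rename_mem_vanishingIdeal_liftVar {S : Set (Fin d ⊕ Fin d → K)}
    {f : MvPolynomial (Fin d ⊕ Fin d) K} (hf : f ∈ vanishingIdeal K S) :
    rename (Sum.map (Fin.castSucc (n := d)) (Fin.castSucc (n := d))) f ∈
      vanishingIdeal K (liftVar e S) := by
  rw [mem_vanishingIdeal_liftVar_iff]
  intro k
  rw [liftHom_rename, Polynomial.coeff_C]
  by_cases hk : k = 0
  · rw [if_pos hk]; exact hf
  · rw [if_neg hk]; exact Ideal.zero_mem _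

/-- The defining equation `y_last - x_last · e(x, y)` vanishes on the lift. [folklore] -/
theorem equation_mem_vanishingIdeal_liftVar (S : Set (Fin d ⊕ Fin d → K)) :
    (X (Sum.inr (Fin.last d)) - X (Sum.inl (Fin.last d)) *
        rename (Sum.map (Fin.castSucc (n := d)) (Fin.castSucc (n := d))) e :
      MvPolynomial (Fin (d + 1) ⊕ Fin (d + 1)) K) ∈ vanishingIdeal K (liftVar e S) := by
  rw [mem_vanishingIdeal_liftVar_iff]
  intro k
  rw [map_sub, map_mul, liftHom_X_inr_last, liftHom_X_inl_last, liftHom_rename, sub_self,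
    Polynomial.coeff_zero]
  exact Ideal.zero_mem _

/-- **The lift of a Zariski closed set is Zariski closed**: `W_e(S) = Z(I(W_e(S)))`. [folklore] -/
theorem isZariskiClosed_liftVar {S : Set (Fin d ⊕ Fin d → K)} (hS : IsZariskiClosed K S) :
    IsZariskiClosed K (liftVar e S) := by
  refine ⟨vanishingIdeal K (liftVar e S), le_antisymm (zeroLocus_vanishingIdeal_le _) ?_⟩
  intro w hw
  rw [mem_zeroLocus_iff] at hw
  have hS' : S = zeroLocus K (vanishingIdeal K S) := eq_zeroLocus_vanishingIdeal_of_isZariskiClosed hS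
  refine ⟨?_, ?_⟩
  · rw [hS', mem_zeroLocus_iff]
    intro f hf
    have := hw _ (rename_mem_vanishingIdeal_liftVar e hf)
    rwa [aeval_rename] at this
  · have := hw _ (equation_mem_vanishingIdeal_liftVar e S)
    rw [map_sub, map_mul, aeval_X, aeval_X, aeval_rename, sub_eq_zero] at this
    rw [this]
    rfl

/-! ## The coordinate ring of the lift is `K[S][T]` -/

/-- The substitution followed by reduction of coefficients modulo `I(S)`:
`K[x, x_last, y, y_last] → (K[x,y] ⧸ I(S))[T]`. [folklore] -/
def liftQuot (S : Set (Fin d ⊕ Fin d → K)) :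
    MvPolynomial (Fin (d + 1) ⊕ Fin (d + 1)) K →+*
      Polynomial (MvPolynomial (Fin d ⊕ Fin d) K ⧸ vanishingIdeal K S) :=
  (Polynomial.mapRingHom (Ideal.Quotient.mk (vanishingIdeal K S))).comp (liftHom e).toRingHom

omit [Infinite K] in
/-- `liftHom e` is onto `K[x,y][T]` (`C f = liftHom e f(x,y)`, `T = liftHom e x_last`). [folklore] -/
theorem liftHom_surjective : Function.Surjective (liftHom (K := K) e) := by
  intro q
  refine ⟨∑ k ∈ q.support, rename (Sum.map (Fin.castSucc (n := d)) (Fin.castSucc (n := d)))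
    (q.coeff k) * X (Sum.inl (Fin.last d)) ^ k, ?_⟩
  rw [map_sum]
  conv_rhs => rw [← Polynomial.sum_C_mul_X_pow_eq q]
  refine Finset.sum_congr rfl fun k _ => ?_
  rw [map_mul, map_pow, liftHom_rename, liftHom_X_inl_last]

omit [Infinite K] in
/-- `liftQuot e S` is onto `K[S][T]`. [folklore] -/
theorem liftQuot_surjective (S : Set (Fin d ⊕ Fin d → K)) : Function.Surjective (liftQuot e S) :=
  (Polynomial.map_surjective _ Ideal.Quotient.mk_surjective).comp (liftHom_surjective e)

/-- **`I(W_e(S)) = ker (K[x, x_last, y, y_last] → K[S][T])`.** [folklore] -/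
theorem vanishingIdeal_liftVar_eq_ker (S : Set (Fin d ⊕ Fin d → K)) :
    vanishingIdeal K (liftVar e S) = RingHom.ker (liftQuot e S) := by
  rw [liftQuot, ← RingHom.comap_ker, Polynomial.ker_mapRingHom, Ideal.mk_ker, vanishingIdeal_liftVar]
  rfl

/-- **The coordinate ring of `W_e(S)` is `K[S][T]`.** [folklore] -/
def coordRingLiftVarEquiv (S : Set (Fin d ⊕ Fin d → K)) :
    (MvPolynomial (Fin (d + 1) ⊕ Fin (d + 1)) K ⧸ vanishingIdeal K (liftVar e S)) ≃+*
      Polynomial (MvPolynomial (Fin d ⊕ Fin d) K ⧸ vanishingIdeal K S) :=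
  (Ideal.quotEquivOfEq (vanishingIdeal_liftVar_eq_ker e S)).trans
    (RingHom.quotientKerEquivOfSurjective (liftQuot_surjective e S))

/-- **The lift of an irreducible closed set is irreducible closed** (`I(W_e(S))` is the kernel of a
map onto the domain `K[S][T]`). [folklore] -/
theorem isIrreducibleClosed_liftVar {S : Set (Fin d ⊕ Fin d → K)} (hS : IsIrreducibleClosed K S) :
    IsIrreducibleClosed K (liftVar e S) := by
  refine ⟨isZariskiClosed_liftVar e hS.1, ?_⟩
  haveI := hS.2
  rw [vanishingIdeal_liftVar_eq_ker]
  exact RingHom.ker_isPrime _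

/-- **`dim W_e(S) = dim S + 1`** (`dim K[S][T] = dim K[S] + 1`, `K[S]` Noetherian). [folklore] -/
theorem zariskiDim_liftVar (S : Set (Fin d ⊕ Fin d → K)) :
    zariskiDim K (liftVar e S) = zariskiDim K S + 1 := by
  unfold zariskiDim
  rw [ringKrullDim_eq_of_ringEquiv
      (S := Polynomial (MvPolynomial (Fin d ⊕ Fin d) K ⧸ vanishingIdeal K S))
      (coordRingLiftVarEquiv e S),
    Polynomial.ringKrullDim_of_isNoetherianRing]

end Summit.Schanuel.Schanuel.Theorems
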